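import Summits.BirchSwinnertonDyer.Uniform.UI.O2SigmaValuation
import Literature.NumberTheory.EllipticCurves.PadicLogNormProofs
import HarnessLib

/-!
# Uniform/UI/O2 — principal units and the NORMALISATION `x(P)·Σ²_E(P) ≡ 1 (mod p)`

HONEST FRAMING (cell `bsd-uniform`, seat `ui-o2`, gen 8): THEOREMS ONLY — `p`-adic analysis in `ℚ_p` for
`p` odd, about the OBJECT of the conjecture typed in `Uniform/UI/O2.lean` (`tateSigmaValueSq`, the number
`Σ²_E(P) = C²σ_q(u(P))²`); no definition, no named fact, no `sorry`; everything is UNCONDITIONAL (the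
conjecture `TateSigmaIrrationalAtThree` is assumed nowhere and stays OPEN); nothing here proves BSD for
any curve, books anything or moves a census mark (PLAN D7). First of three gen-8 files
(`O2SigmaNormalisation` → `O2DenominatorSquare` → `O2PrincipalUnit`); section numbers are shared.

What this file adds — the first-order refinement of gen 5's valuation theorem
(`O2SigmaValuation.norm_tateSigmaValueSq_eq`: `‖Σ²_W(P)‖_p = ‖x(P)‖_p⁻¹`):

* §1 principal units of `ℚ_p` (`‖u − 1‖_p < 1`): a group under `·`, `⁻¹`, powers; two principal units
  that agree up to sign agree (`p` odd); `‖t‖ < 1 ⟹ ‖t‖ ≤ p⁻¹`; an infinite product of principal units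
  is a principal unit with the same bound (`norm_tprod_sub_one_le`).
* §2 the two series of the tree's transcription of Stein–Wuthrich §4.2 are principal units: the
  `q`-product `Π` of `σ_q(u)² = 2(c − 1)·Π` (`SteinWuthrich2013.tateSigmaSq`; gen 5 had `‖Π‖ = 1`, here
  `‖Π − 1‖ < 1`), and `2(ch(L) − 1) = L + O(‖L‖/p)` (`SteinWuthrich2013.coshOfSq`).
* §3 for a point `(x, y)` with `‖x‖_p > 1` of a `p`-integral equation, `‖x³ − y²‖_p < ‖y‖_p²`, i.e.
  `x³/y² ≡ 1` — the formal-group statement `x·z² = 1 + O(z)`, `z = −x/y` (AEC IV.1, VII.2.2) —, and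
  **THE NORMALISATION `‖x(P)·Σ²_W(P) − 1‖_p < 1`** (`norm_x_mul_tateSigmaValueSq_sub_one_lt_one`) for `W/ℚ`
  globally minimal multiplicative at an odd `p`, any `‖q‖_p < 1`, any rational affine `P` with
  `‖x‖_p > 1`: in `Σ² = C²·2(ch(L) − 1)·Π`, `L = log_E(z)²/C²`, the scale `C²` cancels
  (`C²·2(ch(L) − 1) = log_E(z)² + O(‖z‖²/p)`), `log_E(z) = z + O(‖z‖²)` (tree, AEC IV.6.4) and `x·z² ≡ 1`;
  this is the `p`-adic shadow of `σ(z)² = z² + O(z⁴)`, `x = z⁻² + O(z⁻¹)`. Corollary: with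
  `U(P) = Σ²/den x` (gen 5's unit) and `x·den x = num x`, **`U(P)·num x(P) ≡ 1 (mod p)`** — the residue of
  the unit `U(P)` is the inverse residue of the numerator of `x(P)`.

Not here (next two files): `den x(P)` is a square and `num x(P) ≡ 1 (mod 3)`; `U(P) ≡ 1 (mod 3)` and its
consequences. References: [SteinWuthrich2013] §4.2; [SilvermanAEC2009] IV.1, IV.6.4, VII.2.2;
[Serre1973] Ch. II §3.1; write-up `HOME/ui/O2-CONJECTURE.md` §13.
-/

noncomputable section

open scoped Classical
open Filter Topology IsUltrametricDist
open WeierstrassCurve Literature.NumberTheory.EllipticCurves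
open Literature.NumberTheory.EllipticCurves.SteinWuthrich2013
open Literature.NumberTheory.EllipticCurves.Rank1Residual

namespace Summit.BirchSwinnertonDyer.Uniform.UI.O2

variable {p : ℕ} [hp : Fact p.Prime]

/-! ### §1 Principal units of `ℚ_p` (`‖u − 1‖_p < 1`) -/

/-- A principal unit is a unit: `‖a − 1‖_p < 1 ⟹ ‖a‖_p = 1`. [folklore] -/
theorem norm_eq_one_of_norm_sub_one_lt_one {a : ℚ_[p]} (ha : ‖a - 1‖ < 1) : ‖a‖ = 1 := by
  have h := norm_one_add_eq_one_of_norm_lt_one ha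
  rwa [add_sub_cancel] at h

/-- Principal units are closed under multiplication: `(1 + s)(1 + t) − 1 = s(1 + t) + t`. [folklore] -/
theorem norm_mul_sub_one_lt_one {a b : ℚ_[p]} (ha : ‖a - 1‖ < 1) (hb : ‖b - 1‖ < 1) :
    ‖a * b - 1‖ < 1 := by
  have hb1 : ‖b‖ = 1 := norm_eq_one_of_norm_sub_one_lt_one hb
  have e : a * b - 1 = (a - 1) * b + (b - 1) := by ring
  rw [e]
  refine (norm_add_le_max _ _).trans_lt (max_lt ?_ hb)
  rw [norm_mul, hb1, mul_one]
  exact ha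

/-- Principal units are closed under inversion: `a⁻¹ − 1 = a⁻¹(1 − a)`. [folklore] -/
theorem norm_inv_sub_one_lt_one {a : ℚ_[p]} (ha : ‖a - 1‖ < 1) : ‖a⁻¹ - 1‖ < 1 := by
  have ha1 : ‖a‖ = 1 := norm_eq_one_of_norm_sub_one_lt_one ha
  have ha0 : a ≠ 0 := norm_pos_iff.mp (by rw [ha1]; exact one_pos)
  have e : a⁻¹ - 1 = a⁻¹ * (1 - a) := by rw [mul_sub, mul_one, inv_mul_cancel₀ ha0]
  rw [e, norm_mul, norm_inv, ha1, inv_one, one_mul, norm_sub_rev]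
  exact ha

/-- Principal units are closed under division. [folklore] -/
theorem norm_div_sub_one_lt_one {a b : ℚ_[p]} (ha : ‖a - 1‖ < 1) (hb : ‖b - 1‖ < 1) :
    ‖a / b - 1‖ < 1 := by
  rw [div_eq_mul_inv]
  exact norm_mul_sub_one_lt_one ha (norm_inv_sub_one_lt_one hb)

/-- Principal units are closed under powers. [folklore] -/
theorem norm_pow_sub_one_lt_one {a : ℚ_[p]} (ha : ‖a - 1‖ < 1) (n : ℕ) : ‖a ^ n - 1‖ < 1 := by
  induction n with
  | zero => simp
  | succ n ih =>
    rw [pow_succ]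
    exact norm_mul_sub_one_lt_one ih ha

/-- **Two principal units that agree up to sign agree** (`p` odd): `a = −b` would give `a + b = 0`, but
`a + b = 2 + (a − 1) + (b − 1)` has norm `‖2‖_p = 1`. This is the lemma that removes the `±` of gen 7's
statements once `U(P) ≡ 1`. [folklore] -/
theorem eq_of_eq_or_eq_neg_of_norm_sub_one_lt_one (hp2 : p ≠ 2) {a b : ℚ_[p]} (ha : ‖a - 1‖ < 1)
    (hb : ‖b - 1‖ < 1) (h : a = b ∨ a = -b) : a = b := by
  rcases h with h | h
  · exact h
  · exfalso
    have h2 : ‖(2 : ℚ_[p])‖ = 1 := by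
      simpa using Padic.norm_natCast_eq_one_iff.mpr ((Nat.coprime_primes hp.out Nat.prime_two).mpr hp2)
    have hlt : ‖(a - 1) + (b - 1)‖ < 1 := (norm_add_le_max _ _).trans_lt (max_lt ha hb)
    have hsum : ‖a + b‖ = 1 := by
      have e : a + b = 2 + ((a - 1) + (b - 1)) := by ring
      rw [e, norm_add_eq_max_of_norm_ne_norm (by rw [h2]; exact hlt.ne'), h2, max_eq_left hlt.le]
    rw [h, neg_add_cancel, norm_zero] at hsum
    exact zero_ne_one hsum

/-- **Infinite products of principal units are principal units, with the same bound**: if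
`‖f n − 1‖_p ≤ r ≤ 1` for every `n` then `‖∏' n, f n − 1‖_p ≤ r` (the finite partial products satisfy it
by the ultrametric inequality, the limit by closedness; a non-multipliable `tprod` is `1`).
[folklore] -/
theorem norm_tprod_sub_one_le {f : ℕ → ℚ_[p]} {r : ℝ} (hr0 : 0 ≤ r) (hr1 : r ≤ 1)
    (hf : ∀ n, ‖f n - 1‖ ≤ r) : ‖(∏' n, f n) - 1‖ ≤ r := by
  have hfin : ∀ s : Finset ℕ, ‖(∏ n ∈ s, f n) - 1‖ ≤ r := by
    intro s
    refine Finset.induction_on s (by simp [hr0]) ?_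
    intro a s has ih
    rw [Finset.prod_insert has]
    have hP1 : ‖∏ n ∈ s, f n‖ ≤ 1 := by
      have e : ∏ n ∈ s, f n = 1 + ((∏ n ∈ s, f n) - 1) := by ring
      rw [e]
      exact (norm_add_le_max _ _).trans (max_le (by rw [norm_one]) (ih.trans hr1))
    have e : f a * ∏ n ∈ s, f n - 1 = (f a - 1) * ∏ n ∈ s, f n + ((∏ n ∈ s, f n) - 1) := by ring
    rw [e]
    refine (norm_add_le_max _ _).trans (max_le ?_ ih)
    rw [norm_mul]
    calc ‖f a - 1‖ * ‖∏ n ∈ s, f n‖ ≤ r * 1 := mul_le_mul (hf a) hP1 (norm_nonneg _) hr0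
      _ = r := mul_one r
  by_cases hm : Multipliable f
  · have hP : Tendsto (fun s : Finset ℕ => ∏ n ∈ s, f n) atTop (𝓝 (∏' n, f n)) := hm.hasProd
    have hP' : Tendsto (fun s : Finset ℕ => ‖(∏ n ∈ s, f n) - 1‖) atTop (𝓝 ‖(∏' n, f n) - 1‖) :=
      (hP.sub tendsto_const_nhds).norm
    exact le_of_tendsto' hP' hfin
  · rw [tprod_eq_one_of_not_multipliable hm, sub_self, norm_zero]
    exact hr0

/-! ### §2 The two series of the transcription are principal units -/

/-- Each factor `(1 − 2qⁿ⁺¹c + q^{2(n+1)})²/(1 − qⁿ⁺¹)⁴` of the `q`-product in `σ_q(u)²`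
(`SteinWuthrich2013.tateSigmaSq`) is a principal unit for `‖q‖_p < 1`, `‖c‖_p ≤ 1` (numerator and
denominator are `1 + O(q)`). [cite: SteinWuthrich2013, §4.2 (p. 15)] -/
theorem norm_tateSigmaSq_factor_sub_one_lt_one {q c : ℚ_[p]} (hq : ‖q‖ < 1) (hc : ‖c‖ ≤ 1) (n : ℕ) :
    ‖(1 - 2 * q ^ (n + 1) * c + q ^ (2 * (n + 1))) ^ 2 / (1 - q ^ (n + 1)) ^ 4 - 1‖ < 1 := by
  have hqn : ‖q ^ (n + 1)‖ < 1 := by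
    rw [norm_pow]
    exact pow_lt_one₀ (norm_nonneg _) hq (Nat.succ_ne_zero n)
  have h2 : ‖(2 : ℚ_[p])‖ ≤ 1 := by
    have h : ((2 : ℤ) : ℚ_[p]) = 2 := by norm_cast
    rw [← h]
    exact Padic.norm_int_le_one 2
  have hN : ‖(1 - 2 * q ^ (n + 1) * c + q ^ (2 * (n + 1))) - 1‖ < 1 := by
    have e : (1 - 2 * q ^ (n + 1) * c + q ^ (2 * (n + 1))) - 1 =
        q ^ (2 * (n + 1)) + -(2 * q ^ (n + 1) * c) := by ring
    rw [e]
    refine (norm_add_le_max _ _).trans_lt (max_lt ?_ ?_)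
    · rw [norm_pow]
      exact pow_lt_one₀ (norm_nonneg _) hq (by omega)
    · rw [norm_neg, norm_mul, norm_mul]
      calc ‖(2 : ℚ_[p])‖ * ‖q ^ (n + 1)‖ * ‖c‖ ≤ 1 * ‖q ^ (n + 1)‖ * 1 := by gcongr
        _ = ‖q ^ (n + 1)‖ := by ring
        _ < 1 := hqn
  have hD : ‖(1 - q ^ (n + 1)) - 1‖ < 1 := by
    rw [sub_sub_cancel_left, norm_neg]
    exact hqn
  exact norm_div_sub_one_lt_one (norm_pow_sub_one_lt_one hN 2) (norm_pow_sub_one_lt_one hD 4)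

/-- **The `q`-product `Π` of `σ_q(u)²` is a principal unit**: `‖Π − 1‖_p < 1` for `‖q‖_p < 1`,
`‖c‖_p ≤ 1` (gen 5 had `‖Π‖_p = 1`). [cite: SteinWuthrich2013, §4.2 (p. 15)] -/
theorem norm_tprod_tateSigmaSq_factor_sub_one_lt_one {q c : ℚ_[p]} (hq : ‖q‖ < 1) (hc : ‖c‖ ≤ 1) :
    ‖(∏' n : ℕ, (1 - 2 * q ^ (n + 1) * c + q ^ (2 * (n + 1))) ^ 2 / (1 - q ^ (n + 1)) ^ 4) - 1‖
      < 1 := by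
  have hp1 : (1 : ℝ) < p := by exact_mod_cast hp.out.one_lt
  have hpi : (p : ℝ)⁻¹ < 1 := inv_lt_one_of_one_lt₀ hp1
  refine lt_of_le_of_lt (norm_tprod_sub_one_le (by positivity) hpi.le fun n => ?_) hpi
  exact norm_le_inv_of_norm_lt_one (norm_tateSigmaSq_factor_sub_one_lt_one hq hc n)

/-- **`2(ch(L) − 1) = L·(1 + O(p⁻¹))`, additive form**: `‖2(ch(L) − 1) − L‖_p ≤ ‖L‖_p/p` on
`‖L‖_p ≤ p⁻²`, `p` odd (gen 5's `coshOfSq_eq_one_add_half_add`: `ch(L) = 1 + L/2 + R`, `‖R‖ ≤ ‖L‖/p`).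
[folklore] -/
theorem norm_two_mul_coshOfSq_sub_one_sub_le (hp2 : p ≠ 2) {L : ℚ_[p]}
    (hL : ‖L‖ ≤ ((p : ℝ)⁻¹) ^ 2) : ‖2 * (coshOfSq L - 1) - L‖ ≤ ‖L‖ * (p : ℝ)⁻¹ := by
  obtain ⟨R, hR, hRle⟩ := coshOfSq_eq_one_add_half_add hp2 hL
  have h2n : ‖(2 : ℚ_[p])‖ = 1 := by
    simpa using Padic.norm_natCast_eq_one_iff.mpr ((Nat.coprime_primes hp.out Nat.prime_two).mpr hp2)
  have h2 : (2 : ℚ_[p]) ≠ 0 := norm_pos_iff.mp (by rw [h2n]; exact one_pos)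
  have hkey : 2 * (coshOfSq L - 1) - L = 2 * R := by
    rw [hR]
    field_simp
    ring
  rw [hkey, norm_mul, h2n, one_mul]
  exact hRle

/-! ### §3 The normalisation `x(P)·Σ²_E(P) ≡ 1` at every odd multiplicative prime -/

/-- **`‖x³ − y²‖_p < ‖y‖_p²` for a point `(x, y)` with `‖x‖_p > 1` of a `p`-integral Weierstrass equation**:
`x³ − y² = a₁xy + a₃y − a₂x² − a₄x − a₆` and every term on the right is smaller than `‖y‖² = ‖x‖³`
(`‖x‖ < ‖y‖`, tree `norm_sq_eq_norm_cube`). The formal-group statement `x·z² = 1 + O(z)`, `z = −x/y`.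
[cite: SilvermanAEC2009, VII.2.2 and IV.1] -/
theorem norm_pow_three_sub_sq_lt {V : WeierstrassCurve ℚ_[p]} [V.IsIntegral ℤ_[p]] {x y : ℚ_[p]}
    (heq : V.toAffine.Equation x y) (hx : 1 < ‖x‖) : ‖x ^ 3 - y ^ 2‖ < ‖y‖ ^ 2 := by
  obtain ⟨h₁, h₂, h₃, h₄, h₆⟩ := V.norm_coeffs_le_one
  obtain ⟨hsq, hxy⟩ := V.norm_sq_eq_norm_cube heq hx
  rw [Affine.equation_iff] at heq
  have hy1 : 1 < ‖y‖ := hx.trans hxy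
  have hy0 : 0 < ‖y‖ := one_pos.trans hy1
  have hyy : ‖y‖ < ‖y‖ ^ 2 := by nlinarith
  have hxx : ‖x‖ ^ 2 < ‖y‖ ^ 2 := by nlinarith [norm_nonneg x]
  have e : x ^ 3 - y ^ 2 =
      V.a₁ * x * y + (V.a₃ * y + (-(V.a₂ * x ^ 2) + (-(V.a₄ * x) + -V.a₆))) := by
    linear_combination -heq
  rw [e]
  refine (norm_add_le_max _ _).trans_lt (max_lt ?_ ((norm_add_le_max _ _).trans_lt (max_lt ?_
    ((norm_add_le_max _ _).trans_lt (max_lt ?_ ((norm_add_le_max _ _).trans_lt (max_lt ?_ ?_)))))))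
  · rw [norm_mul, norm_mul]
    calc ‖V.a₁‖ * ‖x‖ * ‖y‖ ≤ 1 * ‖x‖ * ‖y‖ := by gcongr
      _ = ‖x‖ * ‖y‖ := by ring
      _ < ‖y‖ * ‖y‖ := mul_lt_mul_of_pos_right hxy hy0
      _ = ‖y‖ ^ 2 := (sq ‖y‖).symm
  · rw [norm_mul]
    calc ‖V.a₃‖ * ‖y‖ ≤ 1 * ‖y‖ := by gcongr
      _ = ‖y‖ := one_mul _
      _ < ‖y‖ ^ 2 := hyy
  · rw [norm_neg, norm_mul, norm_pow]
    calc ‖V.a₂‖ * ‖x‖ ^ 2 ≤ 1 * ‖x‖ ^ 2 := by gcongr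
      _ = ‖x‖ ^ 2 := one_mul _
      _ < ‖y‖ ^ 2 := hxx
  · rw [norm_neg, norm_mul]
    calc ‖V.a₄‖ * ‖x‖ ≤ 1 * ‖x‖ := by gcongr
      _ = ‖x‖ := one_mul _
      _ < ‖y‖ := hxy
      _ < ‖y‖ ^ 2 := hyy
  · rw [norm_neg]
    calc ‖V.a₆‖ ≤ 1 := h₆
      _ < ‖y‖ := hy1
      _ < ‖y‖ ^ 2 := hyy

/-- **`x³/y² ≡ 1 (mod p)`** for a point `(x, y)` with `‖x‖_p > 1` of a `p`-integral equation:
`‖x³/y² − 1‖_p < 1` — i.e. `x·z² ≡ 1` for the formal-group parameter `z = −x/y`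
(`x = z⁻² − a₁z⁻¹ − …`). [cite: SilvermanAEC2009, IV.1 and VII.2.2] -/
theorem norm_pow_three_div_sq_sub_one_lt_one {V : WeierstrassCurve ℚ_[p]} [V.IsIntegral ℤ_[p]]
    {x y : ℚ_[p]} (heq : V.toAffine.Equation x y) (hx : 1 < ‖x‖) : ‖x ^ 3 / y ^ 2 - 1‖ < 1 := by
  obtain ⟨-, hxy⟩ := V.norm_sq_eq_norm_cube heq hx
  have hy0 : y ≠ 0 := by
    intro h
    rw [h, norm_zero] at hxy
    linarith [norm_nonneg x]
  have hy2 : y ^ 2 ≠ 0 := pow_ne_zero 2 hy0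
  have e : x ^ 3 / y ^ 2 - 1 = (x ^ 3 - y ^ 2) / y ^ 2 := by field_simp
  rw [e, norm_div, norm_pow, div_lt_one (pow_pos (norm_pos_iff.mpr hy0) 2)]
  exact norm_pow_three_sub_sq_lt heq hx

variable {W : WeierstrassCurve ℚ}

/-- **THE NORMALISATION `x(P)·Σ²_E(P) ≡ 1 (mod p)`.** For `W/ℚ` globally minimal with multiplicative
reduction at an odd prime `p`, ANY `q ∈ ℚ_p` with `‖q‖_p < 1` and any rational affine `P = (x, y)` with
`‖x‖_p > 1`: `‖x(P)·Σ²_W(P) − 1‖_p < 1`. Mechanism, in the tree's transcription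
`Σ² = C²·2(ch(L) − 1)·Π`, `L = log_E(z)²/C²`, `z = −x/y`: `C²·2(ch(L) − 1) = log_E(z)² + 2C²R` with
`‖2C²R‖ ≤ ‖z‖²/p` (§2), `‖Π − 1‖ < 1` (§2), `‖log_E(z) − z‖ ≤ 2‖z‖²` (tree, AEC IV.6.4),
`‖x·z² − 1‖ = ‖x³/y² − 1‖ < 1` (above) and `‖x‖·‖z‖² = 1`; the transcendental scale `C²` cancels, as in
gen 5's valuation theorem, of which this is the first-order refinement (`σ(z)² = z² + O(z⁴)`,
`x = z⁻² + O(z⁻¹)`). Unconditional; nothing about `q ≠ 0`, `j(q) = j(W)` or the reduction of `P` is used.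
[cite: SteinWuthrich2013, §4.2] [cite: SilvermanAEC2009, IV.1, IV.6.4, VII.2.2] -/
theorem norm_x_mul_tateSigmaValueSq_sub_one_lt_one (hp2 : p ≠ 2) [W.IsElliptic] [W.IsGloballyMinimal]
    (hW : Mult W p) {q : ℚ_[p]} (hq : ‖q‖ < 1) {x y : ℚ} (hxy : W.toAffine.Nonsingular x y)
    (hx : 1 < ‖(x : ℚ_[p])‖) :
    ‖(x : ℚ_[p]) * tateSigmaValueSq W p q x y - 1‖ < 1 := by
  -- the objects
  set X : ℚ_[p] := (x : ℚ_[p]) with hXdef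
  set Y : ℚ_[p] := (y : ℚ_[p]) with hYdef
  set V : WeierstrassCurve ℚ_[p] := W.baseChange ℚ_[p] with hVdef
  set z : ℚ_[p] := -X / Y with hzdef
  set ℓ : ℚ_[p] := V.padicFormalLog z with hℓdef
  set C2 : ℚ_[p] := uniformisationScaleSq W p q with hC2def
  set L : ℚ_[p] := logUnitParamSq W p q x y with hLdef
  set Pr : ℚ_[p] := ∏' n : ℕ, (1 - 2 * q ^ (n + 1) * coshOfSq L + q ^ (2 * (n + 1))) ^ 2 /
    (1 - q ^ (n + 1)) ^ 4 with hPrdef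
  have hSig : tateSigmaValueSq W p q x y = C2 * (2 * (coshOfSq L - 1) * Pr) := rfl
  have hL : L = ℓ ^ 2 / C2 := rfl
  -- basic facts
  have hp1 : (1 : ℝ) < p := by exact_mod_cast hp.out.one_lt
  have hp0 : (0 : ℝ) < p := by positivity
  have hp3 : (3 : ℝ) ≤ p := by
    have h := hp.out.two_le
    have h3 : 3 ≤ p := by omega
    exact_mod_cast h3
  have hpi3 : (p : ℝ)⁻¹ ≤ 3⁻¹ := by
    rw [inv_le_inv₀ hp0 (by norm_num)]
    exact hp3
  obtain ⟨hz, hz2⟩ := norm_neg_div_of_one_lt_norm (p := p) hxy hx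
  obtain ⟨hC1, hC0⟩ := one_le_norm_uniformisationScaleSq hW hq
  have heq : V.toAffine.Equation X Y := (nonsingular_ratCast (p := p) hxy).left
  have hX0 : X ≠ 0 := norm_pos_iff.mp (one_pos.trans hx)
  have hXz : ‖X‖ * ‖z‖ ^ 2 = 1 := by rw [hz2, mul_inv_cancel₀ (one_pos.trans hx).ne']
  -- the formal logarithm
  have hzhalf : ‖z‖ ≤ 1 / 2 := hz.trans (hpi3.trans (by norm_num))
  have hℓz : ‖ℓ - z‖ ≤ 2 * ‖z‖ ^ 2 :=
    Summit.BirchSwinnertonDyer.Rank1Residual.O5.HeegnerLogTransport.norm_padicFormalLog_sub_self_le_of_norm_le_half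
      V hzhalf
  have hℓn : ‖ℓ‖ = ‖z‖ :=
    Summit.BirchSwinnertonDyer.Rank1Residual.O5.HeegnerLogTransport.norm_padicFormalLog_eq_of_norm_le_inv
      V hp2 hz
  -- the disc of `ch`
  have hLnorm : ‖L‖ = ‖z‖ ^ 2 / ‖C2‖ := by rw [hL, norm_div, norm_pow, hℓn]
  have hCL : ‖C2‖ * ‖L‖ = ‖z‖ ^ 2 := by
    rw [hLnorm, mul_div_cancel₀ _ (norm_pos_iff.mpr hC0).ne']
  have hLle : ‖L‖ ≤ ((p : ℝ)⁻¹) ^ 2 := by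
    rw [hLnorm]
    calc ‖z‖ ^ 2 / ‖C2‖ ≤ ‖z‖ ^ 2 / 1 := div_le_div_of_nonneg_left (by positivity) one_pos hC1
      _ ≤ ((p : ℝ)⁻¹) ^ 2 := by rw [div_one]; exact pow_le_pow_left₀ (norm_nonneg _) hz 2
  obtain ⟨R, hR, hRle⟩ := coshOfSq_eq_one_add_half_add hp2 hLle
  have hc1 : ‖coshOfSq L‖ ≤ 1 := (norm_coshOfSq_eq_one hp2 hLle).le
  have hPr : ‖Pr - 1‖ < 1 := norm_tprod_tateSigmaSq_factor_sub_one_lt_one hq hc1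
  -- the decomposition `X·Σ² = (X·ℓ² + 2·X·C2·R)·Π`
  have hdec : X * tateSigmaValueSq W p q x y = (X * ℓ ^ 2 + 2 * X * C2 * R) * Pr := by
    have hCL' : C2 * L = ℓ ^ 2 := by rw [hL, mul_div_cancel₀ _ hC0]
    rw [hSig, hR]
    have e : C2 * (2 * (1 + L / 2 + R - 1) * Pr) = (C2 * L + 2 * C2 * R) * Pr := by ring
    rw [e, hCL']
    ring
  rw [hdec]
  refine norm_mul_sub_one_lt_one ?_ hPr
  -- `X·ℓ² + 2·X·C2·R − 1 = X(ℓ² − z²) + (X·z² − 1) + 2·X·C2·R`, three small terms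
  have e : X * ℓ ^ 2 + 2 * X * C2 * R - 1 =
      X * (ℓ ^ 2 - z ^ 2) + ((X * z ^ 2 - 1) + 2 * X * C2 * R) := by ring
  rw [e]
  refine (norm_add_le_max _ _).trans_lt (max_lt ?_ ((norm_add_le_max _ _).trans_lt (max_lt ?_ ?_)))
  · -- `‖X(ℓ² − z²)‖ = ‖X‖‖ℓ − z‖‖ℓ + z‖ ≤ ‖X‖·2‖z‖²·‖z‖ = 2‖z‖ ≤ 2/3`
    have hsum : ‖ℓ + z‖ ≤ ‖z‖ := (norm_add_le_max _ _).trans (max_le hℓn.le le_rfl)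
    have e2 : ℓ ^ 2 - z ^ 2 = (ℓ - z) * (ℓ + z) := by ring
    rw [norm_mul, e2, norm_mul]
    calc ‖X‖ * (‖ℓ - z‖ * ‖ℓ + z‖) ≤ ‖X‖ * (2 * ‖z‖ ^ 2 * ‖z‖) := by gcongr
      _ = 2 * ‖z‖ * (‖X‖ * ‖z‖ ^ 2) := by ring
      _ = 2 * ‖z‖ := by rw [hXz, mul_one]
      _ ≤ 2 * 3⁻¹ := by gcongr; exact hz.trans hpi3
      _ < 1 := by norm_num
  · -- `X·z² = X³/Y²`
    have eXz : X * z ^ 2 = X ^ 3 / Y ^ 2 := by rw [hzdef, neg_div, neg_sq, div_pow]; ring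
    rw [eXz]
    exact norm_pow_three_div_sq_sub_one_lt_one heq hx
  · -- `‖2·X·C2·R‖ ≤ ‖X‖·‖C2‖·‖L‖/p = ‖X‖‖z‖²/p = 1/p`
    have h2 : ‖(2 : ℚ_[p])‖ = 1 := by
      simpa using Padic.norm_natCast_eq_one_iff.mpr ((Nat.coprime_primes hp.out Nat.prime_two).mpr hp2)
    rw [norm_mul, norm_mul, norm_mul, h2, one_mul]
    calc ‖X‖ * ‖C2‖ * ‖R‖ ≤ ‖X‖ * ‖C2‖ * (‖L‖ * (p : ℝ)⁻¹) := by gcongr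
      _ = ‖X‖ * (‖C2‖ * ‖L‖) * (p : ℝ)⁻¹ := by ring
      _ = (p : ℝ)⁻¹ := by rw [hCL, hXz, one_mul]
      _ < 1 := inv_lt_one_of_one_lt₀ hp1

/-- **The residue of `U(P)` is the inverse residue of the numerator of `x(P)`**: with
`U(P) = Σ²_W(P)/den x(P)` (gen 5: a `p`-adic unit) and `x·den x = num x`,
`‖U(P)·(x·den x(P)) − 1‖_p < 1` — same hypotheses (any odd multiplicative `p`).
[cite: SteinWuthrich2013, §4.2] -/
theorem norm_tateSigmaValueSq_div_den_mul_sub_one_lt_one (hp2 : p ≠ 2) [W.IsElliptic]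
    [W.IsGloballyMinimal] (hW : Mult W p) {q : ℚ_[p]} (hq : ‖q‖ < 1) {x y : ℚ}
    (hxy : W.toAffine.Nonsingular x y) (hx : 1 < ‖(x : ℚ_[p])‖) :
    ‖tateSigmaValueSq W p q x y / ((x.den : ℚ) : ℚ_[p]) * ((x : ℚ_[p]) * ((x.den : ℚ) : ℚ_[p])) - 1‖
      < 1 := by
  have hd0 : ((x.den : ℚ) : ℚ_[p]) ≠ 0 := by exact_mod_cast x.den_nz
  have e : tateSigmaValueSq W p q x y / ((x.den : ℚ) : ℚ_[p]) * ((x : ℚ_[p]) * ((x.den : ℚ) : ℚ_[p])) =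
      (x : ℚ_[p]) * tateSigmaValueSq W p q x y := by
    field_simp
  rw [e]
  exact norm_x_mul_tateSigmaValueSq_sub_one_lt_one hp2 hW hq hxy hx

/-- The same with `num x(P)` spelled out (`x·den x = num x`): `‖U(P)·num x(P) − 1‖_p < 1`.
[cite: SteinWuthrich2013, §4.2] -/
theorem norm_tateSigmaValueSq_div_den_mul_num_sub_one_lt_one (hp2 : p ≠ 2) [W.IsElliptic]
    [W.IsGloballyMinimal] (hW : Mult W p) {q : ℚ_[p]} (hq : ‖q‖ < 1) {x y : ℚ}
    (hxy : W.toAffine.Nonsingular x y) (hx : 1 < ‖(x : ℚ_[p])‖) :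
    ‖tateSigmaValueSq W p q x y / ((x.den : ℚ) : ℚ_[p]) * ((x.num : ℚ) : ℚ_[p]) - 1‖ < 1 := by
  have hnum : ((x.num : ℚ) : ℚ_[p]) = (x : ℚ_[p]) * ((x.den : ℚ) : ℚ_[p]) := by
    rw [← Rat.cast_mul, Rat.mul_den_eq_num]
  rw [hnum]
  exact norm_tateSigmaValueSq_div_den_mul_sub_one_lt_one hp2 hW hq hxy hx

end Summit.BirchSwinnertonDyer.Uniform.UI.O2

end
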